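import Summits.HodgeConjecture.HodgeConjecture.Theorems.MarkmanPartnerTransportLowPicardRMCells
import Summits.HodgeConjecture.HodgeConjecture.Theorems.MarkmanPartnerTransportLowPicardRMTrichotomy

/-!
# Route MarkmanPartnerTransport · crux #5 `LowPicardRealMultiplication` — «RM-SECTORS»: the three sectors
# «`E = ℚ`» ∕ «CM» ∕ «RM with a generator of degree `d ≥ 2`» are EXHAUSTIVE and MUTUALLY EXCLUSIVE by name,
# and crux #5 is EQUIVALENT to HC⁴ on its six cells

By-name closers of the programme «RM-GEN + CELL-SPLIT + RM-EXACT + TRICHOTOMY» of the cell hodge-nonav (planner p1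
g38 ∕ g39; prover seat hodge-nonav-20241-p1, gen 15). For a marked smooth projective `(X, φ, P, z)` (clauses (m1)–(m6);
no `K3^{[2]}`-type hypothesis):

* `not_scalarOnTranscendental_of_rmGenerator`, `not_cm_of_rmGenerator` — an RM generator of degree `d ≥ 2` EXCLUDES
  the scalar sector `ScalarOnT[X, φ]` and the CM sector `CMX[X, φ, z]` («RM-EXACT»
  `not_spannedByIsometries_of_rmGenerator` + `spannedByIsometries_of_scalarOnTranscendental` ∕ `spannedByIsometries_of_cm`);
* `not_scalarOnTranscendental_and_not_cm_iff_exists_rmGenerator` — **`(¬ ScalarOnT ∧ ¬ CMX) ↔ ∃ d ≥ 2, RMgen`**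
  («TRICHOTOMY» `spannedByIsometries_iff_scalar_or_cm` + `not_spannedByIsometries_iff_exists_rmGenerator`);
* `scalarOnTranscendental_or_cm_or_exists_rmGenerator` — **EXHAUSTION**: `ScalarOnT ∨ CMX ∨ ∃ d ≥ 2, RMgen`;
* `not_cm_of_scalarOnTranscendental` — the scalar and CM sectors are DISJOINT too (a rational `(1,1)`-preserving
  `Ψ` with a NON-REAL eigenvalue `μ` on `σ` is type-preserving, so `π_T ∘ Ψ ∘ π_T` is admissible and acts on `σ` —
  which lies in the `T`-domain — by `μ`; a rational scalar there would make `μ` real) — so the three sectors are pairwise exclusive;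
* `lowPicardRealMultiplication_iff_six_cells` — **crux #5 BY NAME ⟺ the conjunction of HC⁴ on its six cells**
  `(ρ(X), [E:ℚ]) ∈ {(1,2), (2,3), (2,7), (3,2), (3,4), (3,5)}` («CELL-SPLIT» `lowPicardRealMultiplication_of_six_cells`
  and the trivial converse: a cell hypothesis `ρ(X) = ρ ≤ 3` is an instance of the route declaration).

This file imports `…LowPicardRMCells` (the programme's route-cone file) because RM-GEN and the route declaration live
there; it is a LEAF (nothing imports it). Notations copied verbatim. No definition, no sorry, no named-fact hypothesis.
`--supports stmt-HodgeConjecture-19653`. Nothing here proves the crux or HC.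

References: Yu. Zarhin, J. reine angew. Math. 341 (1983) Thm. 1.5.1, Thm. 1.6; B. van Geemen, Michigan Math. J. 56
(2008) Lemma 3.2; D. Huybrechts, *Lectures on K3 Surfaces*, Ch. 3 Thm. 3.3.7, Cor. 3.3.6.
-/

noncomputable section

set_option linter.dupNamespace false

open Module CategoryTheory
open Literature.AlgebraicTopology.SingularHomology Literature.Geometry.Kaehler
open Literature.AlgebraicGeometry Literature.AlgebraicGeometry.Motives Literature.AlgebraicGeometry.HodgeTheory
open Literature.AlgebraicGeometry.Hyperkaehler Literature.AlgebraicGeometry.Surfaces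
open Summit.HodgeConjecture.HodgeConjecture.Theorems.NikulinTwinTransport
open Summit.HodgeConjecture.HodgeConjecture.Theorems.MarkmanPartnerTransport.BBFPositivity
open Summit.HodgeConjecture.HodgeConjecture.Theorems.MarkmanPartnerTransport.LatticeBridge

namespace Summit.HodgeConjecture.HodgeConjecture.Theorems.MarkmanPartnerTransport.PartnerLattice

/-- `MarkedK3Sq[X, φ, P, z]`: VERBATIM the `let MarkedK3Sq := …` binder of the route declarations of
MarkmanPartnerTransport (clauses (m1)–(m6)). Local notation only. -/
local notation3 (prettyPrint := false) "MarkedK3Sq[" X ", " φ ", " P ", " z "]" =>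
  (((IsIntegralClass P ∧ ∀ Q : complexBetti X (2 * 4), IsIntegralClass Q → ∃ n : ℤ, Q = n • P) ∧
    (∀ c : complexBetti X 2, IsIntegralClass c ↔ ∃ v : K3HilbertIndex → ℤ, φ c = fun i => (v i : ℂ)) ∧
    (∀ a : complexBetti X 2, cupPowTwo a 4 = ((3 : ℂ) * (k3HilbertForm 2 (φ a) (φ a)) ^ 2) • P) ∧
    (IsOfHodgeType 4 X 2 2 0 (LinearEquiv.symm φ z) ∧
      ∀ τ : complexBetti X 2, IsOfHodgeType 4 X 2 2 0 τ → ∃ t : ℂ, τ = t • LinearEquiv.symm φ z) ∧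
    (∀ c : complexBetti X 2, IsOfHodgeType 4 X 2 1 1 c ↔
      (k3HilbertForm 2 (φ c) z = 0 ∧ k3HilbertForm 2 (φ c) (star z) = 0)) ∧
    (k3HilbertForm 2 z z = 0 ∧ 0 < (k3HilbertForm 2 (star z) z).re)))

/-- `SpIso[X, φ]`: VERBATIM the `let SpannedByIsometries := …` binder of the route declarations (with
`IsBBFTransc` unfolded). Local notation only. -/
local notation3 (prettyPrint := false) "SpIso[" X ", " φ "]" =>
  (∀ f : complexBetti X 2 →ₗ[ℂ] complexBetti X 2, (∀ y, IsRationalClass y → IsRationalClass (f y)) →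
    (∀ (i j : ℕ) y, IsOfHodgeType 4 X 2 i j y → IsOfHodgeType 4 X 2 i j (f y)) →
    (∀ d : complexBetti X 2, d ∈ algebraicClasses X 1 → f d = 0) →
    (∀ y : complexBetti X 2, ∀ d : complexBetti X 2, d ∈ algebraicClasses X 1 →
      k3HilbertForm 2 (φ (f y)) (φ d) = 0) →
    ∃ (k : ℕ) (c : Fin k → ℚ) (g : Fin k → (complexBetti X 2 →ₗ[ℂ] complexBetti X 2)),
      (∀ i, Function.Bijective (g i) ∧ (∀ y, IsRationalClass y → IsRationalClass (g i y)) ∧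
        (∀ (a b : ℕ) y, IsOfHodgeType 4 X 2 a b y → IsOfHodgeType 4 X 2 a b (g i y)) ∧
        (∀ a b, k3HilbertForm 2 (φ (g i a)) (φ (g i b)) = k3HilbertForm 2 (φ a) (φ b))) ∧
      ∀ y : complexBetti X 2, (∀ d : complexBetti X 2, d ∈ algebraicClasses X 1 →
        k3HilbertForm 2 (φ y) (φ d) = 0) → f y = ∑ i : Fin k, ((c i : ℂ) • g i y))

/-- `RMgen[X, φ, z, d]` (VERBATIM `…LowPicardRMCells`): a rational, type-preserving, `q`-self-adjoint endomorphism
`θ` of `H²(X(ℂ); ℂ)` with `θ σ = ev · σ`, `ev` real, `deg minpoly_ℚ(ev) = d`, `d · n + ρ(X) = 23` for some `n ≥ 3`, and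
GEN: every rational type-preserving endomorphism is `Σ_{i<d} cᵢ θⁱ` (`cᵢ ∈ ℚ`) on `T(X)_ℂ`. Local notation only. -/
local notation3 (prettyPrint := false) "RMgen[" X ", " φ ", " z ", " d "]" =>
  (∃ θ : complexBetti X 2 →ₗ[ℂ] complexBetti X 2, (∀ y, IsRationalClass y → IsRationalClass (θ y)) ∧
    (∀ (i j : ℕ) y, IsOfHodgeType 4 X 2 i j y → IsOfHodgeType 4 X 2 i j (θ y)) ∧
    (∀ y w : complexBetti X 2, k3HilbertForm 2 (φ (θ y)) (φ w) = k3HilbertForm 2 (φ y) (φ (θ w))) ∧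
    ∃ ev : ℂ, θ (LinearEquiv.symm φ z) = ev • LinearEquiv.symm φ z ∧ ev.im = 0 ∧
      (minpoly ℚ ev).natDegree = d ∧
      (∃ n : ℕ, 3 ≤ n ∧ d * n + Module.finrank ℂ ↥(algebraicClasses X 1) = 23) ∧
      ∀ f : complexBetti X 2 →ₗ[ℂ] complexBetti X 2, (∀ y, IsRationalClass y → IsRationalClass (f y)) →
        (∀ (i j : ℕ) y, IsOfHodgeType 4 X 2 i j y → IsOfHodgeType 4 X 2 i j (f y)) →
        ∃ c : Fin d → ℚ, ∀ y : complexBetti X 2,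
          (∀ a : complexBetti X 2, a ∈ algebraicClasses X 1 → k3HilbertForm 2 (φ y) (φ a) = 0) →
            f y = ∑ i : Fin d, ((c i : ℂ) • (θ ^ (i : ℕ)) y))

/-- `CMX[X, φ, z]`: "`X` has complex multiplication" in marking coordinates (VERBATIM `…K3Sq2OneCycle`): a rational
endomorphism of `H²(X(ℂ); ℂ)` preserving type `(1,1)` with a NON-REAL eigenvalue on `σ = φ⁻¹ z`. Local notation only. -/
local notation3 (prettyPrint := false) "CMX[" X ", " φ ", " z "]" =>
  (∃ Ψ : complexBetti X 2 →ₗ[ℂ] complexBetti X 2, (∀ y, IsRationalClass y → IsRationalClass (Ψ y)) ∧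
    (∀ y, IsOfHodgeType 4 X 2 1 1 y → IsOfHodgeType 4 X 2 1 1 (Ψ y)) ∧
    ∃ μ : ℂ, μ.im ≠ 0 ∧ Ψ (LinearEquiv.symm φ z) = μ • LinearEquiv.symm φ z)

/-- `ScalarOnT[X, φ]` (VERBATIM `…LowPicardRMTrichotomy`): every rational Hodge endomorphism of `H²(X)` killing
`N¹(X)` with `q`-transcendental image is a RATIONAL SCALAR on the `T`-domain. Local notation only. -/
local notation3 (prettyPrint := false) "ScalarOnT[" X ", " φ "]" =>
  (∀ f : complexBetti X 2 →ₗ[ℂ] complexBetti X 2, (∀ y, IsRationalClass y → IsRationalClass (f y)) →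
    (∀ (i j : ℕ) y, IsOfHodgeType 4 X 2 i j y → IsOfHodgeType 4 X 2 i j (f y)) →
    (∀ d : complexBetti X 2, d ∈ algebraicClasses X 1 → f d = 0) →
    (∀ y : complexBetti X 2, ∀ d : complexBetti X 2, d ∈ algebraicClasses X 1 →
      k3HilbertForm 2 (φ (f y)) (φ d) = 0) →
    ∃ a : ℚ, ∀ y : complexBetti X 2, (∀ d : complexBetti X 2, d ∈ algebraicClasses X 1 →
      k3HilbertForm 2 (φ y) (φ d) = 0) → f y = (a : ℂ) • y)

/-- `CellHC[ρ, d]` (VERBATIM `…LowPicardRMCells`): **HC⁴ on the cell `(ρ(X), [E:ℚ]) = (ρ, d)`**. Local notation only. -/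
local notation3 (prettyPrint := false) "CellHC[" ρ ", " d "]" =>
  (∀ (X : SchemeOver ℂ), IsSmoothProjective 4 X → IsOfK3HilbertSquareType X →
    ∀ (φ : complexBetti X 2 ≃ₗ[ℂ] (K3HilbertIndex → ℂ)) (P : complexBetti X (2 * 4)) (z : K3HilbertIndex → ℂ),
      MarkedK3Sq[X, φ, P, z] → ¬ SpIso[X, φ] → Module.finrank ℂ ↥(algebraicClasses X 1) = ρ →
        RMgen[X, φ, z, d] → HodgeConjectureFor 4 X)

variable {X : SchemeOver ℂ} {φ : complexBetti X 2 ≃ₗ[ℂ] (K3HilbertIndex → ℂ)} {P : complexBetti X (2 * 4)}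
  {z : K3HilbertIndex → ℂ}

/-! ### The RM sector excludes the scalar and the CM sectors -/

/-- **An RM generator of degree `d ≥ 2` excludes the scalar sector `E(X) = ℚ`**: `ScalarOnT ⟹ SpannedByIsometries`
(`spannedByIsometries_of_scalarOnTranscendental`), contradicting «RM-EXACT» (`not_spannedByIsometries_of_rmGenerator`).
[cite: Zarhin1983HodgeGroupsK3, Thm. 1.5.1] -/
theorem not_scalarOnTranscendental_of_rmGenerator (hX : IsSmoothProjective 4 X) (hM : MarkedK3Sq[X, φ, P, z])
    {d : ℕ} (hd : 2 ≤ d) (hR : RMgen[X, φ, z, d]) : ¬ ScalarOnT[X, φ] :=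
  fun h => not_spannedByIsometries_of_rmGenerator hX hM hd hR (spannedByIsometries_of_scalarOnTranscendental h)

/-- **An RM generator of degree `d ≥ 2` excludes complex multiplication**: `CMX ⟹ SpannedByIsometries`
(`spannedByIsometries_of_cm`, Zarhin: a non-real character value spans `E` by Hodge isometries), contradicting
«RM-EXACT» (`not_spannedByIsometries_of_rmGenerator`). [cite: Zarhin1983HodgeGroupsK3, Thm. 1.5.1 and Thm. 1.6]
[cite: Huybrechts2016K3, Ch. 3 Thm. 3.3.7] -/
theorem not_cm_of_rmGenerator (hX : IsSmoothProjective 4 X) (hM : MarkedK3Sq[X, φ, P, z])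
    {d : ℕ} (hd : 2 ≤ d) (hR : RMgen[X, φ, z, d]) : ¬ CMX[X, φ, z] :=
  fun ⟨Ψ, hΨrat, hΨ11, _, hμ, hΨσ⟩ =>
    not_spannedByIsometries_of_rmGenerator hX hM hd hR (spannedByIsometries_of_cm hX hM Ψ hΨrat hΨ11 hΨσ hμ)

/-- **`(¬ ScalarOnT ∧ ¬ CMX) ↔ ∃ d ≥ 2, RMgen`** — the RM sector is EXACTLY the complement of the scalar and CM
sectors («TRICHOTOMY» `spannedByIsometries_iff_scalar_or_cm` and `not_spannedByIsometries_iff_exists_rmGenerator`).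
[cite: Zarhin1983HodgeGroupsK3, Thm. 1.5.1 and Thm. 1.6] [cite: Vangeemen2008, Lemma 3.2] -/
theorem not_scalarOnTranscendental_and_not_cm_iff_exists_rmGenerator (hX : IsSmoothProjective 4 X)
    (hM : MarkedK3Sq[X, φ, P, z]) :
    (¬ ScalarOnT[X, φ] ∧ ¬ CMX[X, φ, z]) ↔ ∃ d : ℕ, 2 ≤ d ∧ RMgen[X, φ, z, d] := by
  rw [← not_or, ← spannedByIsometries_iff_scalar_or_cm hX hM]
  exact not_spannedByIsometries_iff_exists_rmGenerator hX hM

/-- **EXHAUSTION: every marked smooth projective `(X, φ, P, z)` is Hodge-scalar, CM, or carries an RM generator of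
degree `d ≥ 2`** (`ScalarOnT ∨ CMX ∨ ∃ d ≥ 2, RMgen`). [cite: Zarhin1983HodgeGroupsK3, Thm. 1.5.1 and Thm. 1.6]
[cite: Vangeemen2008, Lemma 3.2] -/
theorem scalarOnTranscendental_or_cm_or_exists_rmGenerator (hX : IsSmoothProjective 4 X)
    (hM : MarkedK3Sq[X, φ, P, z]) :
    ScalarOnT[X, φ] ∨ CMX[X, φ, z] ∨ ∃ d : ℕ, 2 ≤ d ∧ RMgen[X, φ, z, d] := by
  classical
  by_cases hsp : SpIso[X, φ]
  · rcases (spannedByIsometries_iff_scalar_or_cm hX hM).1 hsp with h | h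
    · exact Or.inl h
    · exact Or.inr (Or.inl h)
  · exact Or.inr (Or.inr ((not_spannedByIsometries_iff_exists_rmGenerator hX hM).1 hsp))

/-- **The scalar and CM sectors are disjoint**: `σ = φ⁻¹ z` lies in the `T`-domain ((m5): `N¹ ⊂ H^{1,1}` is
`q`-orthogonal to `z`), so a rational `(1,1)`-preserving `Ψ` with `Ψ σ = μ σ`, `μ ∉ ℝ`, restricted through a
transcendental projector `π_T` (`exists_transcendentalProjector`) is an admissible endomorphism `Ψ ∘ π_T` acting on `σ`
by `μ`; were it a rational scalar `a` there, `μ = a` would be real. [cite: Zarhin1983HodgeGroupsK3, Thm. 1.5.1]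
[cite: Huybrechts2016K3, Ch. 3 Cor. 3.3.6] -/
theorem not_cm_of_scalarOnTranscendental (hX : IsSmoothProjective 4 X) (hM : MarkedK3Sq[X, φ, P, z])
    (h : ScalarOnT[X, φ]) : ¬ CMX[X, φ, z] := by
  classical
  rintro ⟨Ψ, hΨrat, hΨ11, μ, hμ, hΨσ⟩
  obtain ⟨-, hint, -, ⟨hz20, hz20'⟩, h11, hzz, hzpos⟩ := id hM
  have hzne : z ≠ 0 := by
    intro h0
    rw [h0, k3HilbertForm_eq_dotProduct] at hzpos
    simp at hzpos
  have hσne : (LinearEquiv.symm φ z) ≠ 0 := fun h0 => hzne (by simpa using congrArg φ h0)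
  have hN11 : ∀ d ∈ algebraicClasses X 1, IsOfHodgeType 4 X 2 1 1 d := fun d hd =>
    isOfHodgeType_of_mem_algebraicClasses_of_isSmoothProjective hX 1 hd
  have hσT : ∀ a ∈ algebraicClasses X 1, k3HilbertForm 2 (φ (LinearEquiv.symm φ z)) (φ a) = 0 := by
    intro a ha
    rw [LinearEquiv.apply_symm_apply, k3HilbertForm_comm]
    exact ((h11 a).1 (hN11 a ha)).1
  -- `Ψ` preserves EVERY Hodge type: it is the complexification of a rational endomorphism with `z` as eigenvector
  -- preserving `{z, z̄}^⊥` (`exists_ratEnd_of_eigen_of_oneOne`), hence type-preserving (`typePreserving_of_markedSq`)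
  obtain ⟨τ, hτM, hτz, hτ11⟩ := exists_ratEnd_of_eigen_of_oneOne hX hM Ψ hΨrat ⟨μ, hΨσ⟩ hΨ11
  have hτMapp : ∀ v, cxEnd τ v = φ (Ψ (φ.symm v)) := fun v => by rw [hτM]; rfl
  have hΨall : ∀ (i j : ℕ) y, IsOfHodgeType 4 X 2 i j y → IsOfHodgeType 4 X 2 i j (Ψ y) := by
    intro i j y hy
    have h := typePreserving_of_markedSq hX hM (cxEnd τ) (fun w => cxEnd_star τ w) hτz hτ11 i j y hy
    rwa [hτMapp, LinearEquiv.symm_apply_apply, LinearEquiv.symm_apply_apply] at h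
  -- the admissible endomorphism `f := π_T ∘ Ψ ∘ π_T`
  obtain ⟨πT, hT1, hT2, hT3, -, hT5, -, hT7⟩ := exists_transcendentalProjector hX hM
  obtain ⟨a, ha⟩ := h (πT ∘ₗ Ψ ∘ₗ πT)
    (fun y hy => by simp only [LinearMap.comp_apply]; exact hT5 _ (hΨrat _ (hT5 _ hy)))
    (fun i j y hy => by simp only [LinearMap.comp_apply]; exact hT7 i j _ (hΨall i j _ (hT7 i j _ hy)))
    (fun d hd => by simp only [LinearMap.comp_apply]; rw [hT1 d hd, map_zero, map_zero])
    (fun y d hd => by simp only [LinearMap.comp_apply]; exact hT3 _ d hd)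
  -- on `σ`: `μ σ = a σ`, so `μ = a` is real
  have hfσ := ha (LinearEquiv.symm φ z) hσT
  simp only [LinearMap.comp_apply] at hfσ
  rw [hT2 _ hσT, hΨσ, map_smul, hT2 _ hσT] at hfσ
  have hμa : μ = (a : ℂ) := smul_left_injective ℂ hσne hfσ
  rw [hμa, Complex.ratCast_im] at hμ
  exact hμ rfl

/-! ### Crux #5 is EQUIVALENT to HC⁴ on its six cells -/

/-- **Crux #5 `LowPicardRealMultiplication` BY NAME ⟺ the conjunction of HC⁴ on its six cells** `(ρ(X), [E:ℚ]) ∈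
{(1,2), (2,3), (2,7), (3,2), (3,4), (3,5)}`: «CELL-SPLIT» (`lowPicardRealMultiplication_of_six_cells`) and the trivial
converse (each cell hypothesis `ρ(X) = ρ` with `ρ ≤ 3` instantiates the route declaration; the `RMgen` datum is not
even needed). [cite: Vangeemen2008, Lemma 3.2] [cite: Zarhin1983HodgeGroupsK3, Thm. 1.5.1] -/
theorem lowPicardRealMultiplication_iff_six_cells :
    Summit.HodgeConjecture.HodgeConjecture.Theses.MarkmanPartnerTransport.LowPicardRealMultiplication ↔
      (CellHC[1, 2] ∧ CellHC[2, 3] ∧ CellHC[2, 7] ∧ CellHC[3, 2] ∧ CellHC[3, 4] ∧ CellHC[3, 5]) := by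
  refine ⟨fun h => ?_, fun ⟨h12, h23, h27, h32, h34, h35⟩ =>
    lowPicardRealMultiplication_of_six_cells h12 h23 h27 h32 h34 h35⟩
  have cell : ∀ ρ d : ℕ, ρ ≤ 3 → CellHC[ρ, d] := fun ρ d hρ X hX hK φ P z hM hsp hρ' _ =>
    h X hX hK φ P z hM hsp (hρ' ▸ hρ)
  exact ⟨cell 1 2 (by norm_num), cell 2 3 (by norm_num), cell 2 7 (by norm_num), cell 3 2 le_rfl,
    cell 3 4 le_rfl, cell 3 5 le_rfl⟩

end Summit.HodgeConjecture.HodgeConjecture.Theorems.MarkmanPartnerTransport.PartnerLattice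

end
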